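import Summits.Ventures.PercRepro.DFSGood
import Summits.Ventures.PercRepro.DecisionTreeVdBK

/-!
# Witnesses at a DFS leaf (Gladkov, proof of Theorem 6.2)

At a stop leaf of the DFS from `a` with targets `{b, c}` (`LeafState`, `DFSTree.lean`), the
queried set `S` contains the backtracking path `P` from `a` to the target `u` found; popped
vertices are fully queried and every queried open edge stays inside the explored set.  So if
`a`, `b`, `c` are joined both in `ω` and in `ω →_S ω'`, the other target `c'` reaches the path in
both configurations through unqueried edges only (`exists_stack_vertex_conn_off`: the first
explored vertex met on a path from `c'` is a stack vertex, and the edges before it lie off `S`).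
Let `v₁`, `v₂` be the stack vertices reached from `c'` through `ω`-open, resp. `ω'`-open,
unqueried edges.  If `v₁` is at least as deep as `v₂` (closer to `a`), the unqueried `ω`-open
edges together with the segment `P[a, v₁]` witness `a ~ c'` in `ω`, and the unqueried `ω'`-open
edges together with `P[v₂, u]` witness `c' ~ u` in `ω →_S ω'`; the two witnesses meet only off
`S` (the two segments are edge-disjoint, `PathOK.split`, `take_drop_disjoint`).  Otherwise swap
the roles.  Hence (`disjOcc_of_leafState`) the pair lies in
`(ab ∪ ac) □_S bc ∪ bc □_S (ab ∪ ac)` — the event bounded by Theorem 4.3 (`DTree.vdbk`).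
-/

namespace PercRepro

variable {E : Type*}

/-- Mixing a configuration with itself changes nothing. -/
theorem mix_self (S : Set E) (ω : Config E) : mix S ω ω = ω := by
  funext e
  by_cases h : e ∈ S
  · exact mix_apply_of_mem h ω ω
  · exact mix_apply_of_notMem h ω ω

/-- The configuration reading `ω` off `S` and closed on `S`. -/
noncomputable def offS (S : Set E) (ω : Config E) : Config E := mix S (fun _ => false) ω

/-- `offS` is open exactly at the open edges off `S`. -/
theorem offS_eq_true_iff {S : Set E} {ω : Config E} {e : E} :
    offS S ω e = true ↔ e ∉ S ∧ ω e = true := by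
  unfold offS
  by_cases h : e ∈ S
  · rw [mix_apply_of_mem h]; simp [h]
  · rw [mix_apply_of_notMem h]; simp [h]

/-- A configuration open wherever `offS S ω` is open dominates it. -/
theorem offS_le {S : Set E} {ω ζ : Config E} (h : ∀ e, e ∉ S → ω e = true → ζ e = true) :
    offS S ω ≤ ζ := by
  intro e
  by_cases he : offS S ω e = true
  · obtain ⟨heS, hωe⟩ := offS_eq_true_iff.mp he
    rw [he, h e heS hωe]
  · simp only [Bool.not_eq_true] at he
    rw [he]; exact Bool.false_le _

/-- A witness of an event is a witness of every larger event. -/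
theorem witness_subset {A A' : Set (Config E)} (hAA' : A ⊆ A') {I : Set E} {ω : Config E}
    (h : Witness A I ω) : Witness A' I ω :=
  fun ω' hω' => hAA' (h ω' hω')

/-- The disjoint occurrence is monotone in both events. -/
theorem disjOcc_mono {A A' B B' : Set (Config E)} (hA : A ⊆ A') (hB : B ⊆ B') {S : Set E}
    {ω ω' : Config E} (h : DisjOcc A B S ω ω') : DisjOcc A' B' S ω ω' := by
  obtain ⟨I, J, hI, hJ, hIJ⟩ := h
  exact ⟨I, J, witness_subset hA hI, witness_subset hB hJ, hIJ⟩

/-- **Edge-disjointness of a prefix and a suffix** of a duplicate-free stack: an edge of the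
first `m` entries is not among the entries after the first `m'` when `m ≤ m'`. -/
theorem take_drop_disjoint {V : Type*} {L : List (E × V)} (hnd : (L.map Prod.fst).Nodup)
    {m m' : ℕ} (hmm : m ≤ m') {e : E} (h1 : e ∈ (L.take m).map Prod.fst)
    (h2 : e ∈ (L.drop m').map Prod.fst) : False := by
  rw [List.map_take] at h1
  rw [List.map_drop] at h2
  have h1' : e ∈ (L.map Prod.fst).take m' := by
    have : (L.map Prod.fst).take m = ((L.map Prod.fst).take m').take m := by
      rw [List.take_take, Nat.min_eq_left hmm]
    rw [this] at h1
    exact List.take_subset _ _ h1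
  have hnd' : ((L.map Prod.fst).take m' ++ (L.map Prod.fst).drop m').Nodup := by
    rw [List.take_append_drop]; exact hnd
  exact List.disjoint_of_nodup_append hnd' h1' h2

namespace MultiGraph

variable {V : Type*} {G : MultiGraph V E}

/-- **The first explored vertex on a path from an unexplored vertex is a stack vertex**, reached
through unqueried edges.  Here `ψ = ω →_S ω''` reads `ω` on `S`; the explored set is that of a
stack `(top, L)` with popped set `Q`, every queried open edge stays inside it, and the popped
vertices are fully queried. -/
theorem exists_stack_vertex_conn_off {S : Set E} {ω ω'' : Config E} {top a c : V}
    {L : List (E × V)} {Q : Finset V} (hpath : G.PathOK ω L top a)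
    (hQ : ∀ q ∈ Q, ∀ e, (G.fst e = q ∨ G.snd e = q) → e ∈ S)
    (hopenIn : ∀ e ∈ S, ω e = true → G.fst e ∈ explored top L Q ∧ G.snd e ∈ explored top L Q)
    (hc : c ∉ explored top L Q) (hconn : G.Conn (mix S ω ω'') c a) :
    ∃ x ∈ top :: L.map Prod.snd, G.Conn (offS S ω'') c x := by
  have hmot := Conn.induction (G := G) (ω := mix S ω ω'') (u := c)
    (motive := fun y => (y ∉ explored top L Q ∧ G.Conn (offS S ω'') c y) ∨
      ∃ x ∈ top :: L.map Prod.snd, G.Conn (offS S ω'') c x)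
    (Or.inl ⟨hc, Conn.refl G _ c⟩) ?_ hconn
  · rcases hmot with ⟨ha, -⟩ | hdone
    · exfalso
      apply ha
      rw [mem_explored]
      rcases List.mem_cons.mp (hpath.bottom_mem) with h | h
      · exact Or.inl h
      · exact Or.inr (Or.inl h)
    · exact hdone
  · intro y z _ hadj hy
    rcases hy with ⟨hy, hcy⟩ | hdone
    · obtain ⟨e, he, hends⟩ := hadj
      by_cases heS : e ∈ S
      · exfalso
        rw [mix_apply_of_mem heS] at he
        have := hopenIn e heS he
        rcases hends with ⟨h1, -⟩ | ⟨-, h2⟩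
        · exact hy (h1 ▸ this.1)
        · exact hy (h2 ▸ this.2)
      · rw [mix_apply_of_notMem heS] at he
        have hoff : offS S ω'' e = true := offS_eq_true_iff.mpr ⟨heS, he⟩
        have hcz : G.Conn (offS S ω'') c z := hcy.trans (Conn.of_openAdj ⟨e, hoff, hends⟩)
        by_cases hz : z ∈ explored top L Q
        · rw [mem_explored] at hz
          rcases hz with hz | hz | hz
          · exact Or.inr ⟨z, by simp [hz], hcz⟩
          · exact Or.inr ⟨z, by simp [hz], hcz⟩
          · exfalso
            apply heS
            refine hQ z hz e ?_
            rcases hends with ⟨-, h2⟩ | ⟨h1, -⟩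
            · exact Or.inr h2
            · exact Or.inl h1
        · exact Or.inl ⟨hz, hcz⟩
    · exact Or.inr hdone

/-- **The witness pair at a stop leaf** (the core of Gladkov's §6.2 argument).  With the stack an
open path `L` from `u` down to `a` inside `S`, the popped set fully queried, queried open edges
inside the explored set, and `c'` unexplored: if `c' ~ a` both in `ω` and in `ω →_S ω'`, then
either `a ~ c'` in `ω` and `c' ~ u` in `ω →_S ω'` occur with witnesses meeting only off `S`, or
`c' ~ u` in `ω` and `a ~ c'` in `ω →_S ω'` do. -/
theorem disjOcc_core {S : Set E} {ω ω' : Config E} {u a c' : V} {L : List (E × V)}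
    {Q : Finset V} (hpath : G.PathOK ω L u a) (hLS : ∀ x ∈ L, x.1 ∈ S)
    (hnd : (L.map Prod.fst).Nodup)
    (hQ : ∀ q ∈ Q, ∀ e, (G.fst e = q ∨ G.snd e = q) → e ∈ S)
    (hopenIn : ∀ e ∈ S, ω e = true → G.fst e ∈ explored u L Q ∧ G.snd e ∈ explored u L Q)
    (hc : c' ∉ explored u L Q) (h1 : G.Conn ω c' a) (h2 : G.Conn (mix S ω ω') c' a) :
    DisjOcc (G.connEvent a c') (G.connEvent c' u) S ω ω' ∨
      DisjOcc (G.connEvent c' u) (G.connEvent a c') S ω ω' := by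
  -- the entry vertices
  have h1' : G.Conn (mix S ω ω) c' a := by rw [mix_self]; exact h1
  obtain ⟨x₁, hx₁, hc₁⟩ := exists_stack_vertex_conn_off hpath hQ hopenIn hc h1'
  obtain ⟨x₂, hx₂, hc₂⟩ := exists_stack_vertex_conn_off hpath hQ hopenIn hc h2
  obtain ⟨m₁, hm₁, rfl⟩ := List.mem_iff_getElem.mp hx₁
  obtain ⟨m₂, hm₂, rfl⟩ := List.mem_iff_getElem.mp hx₂
  obtain ⟨htake₁, hdrop₁⟩ := hpath.split m₁ hm₁
  obtain ⟨htake₂, hdrop₂⟩ := hpath.split m₂ hm₂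
  -- the path edges lie in `S`, so `ω →_S ω'` agrees with `ω` on them
  have hmixL : ∀ x ∈ L, mix S ω ω' x.1 = ω x.1 := fun x hx => mix_apply_of_mem (hLS x hx) ω ω'
  -- unqueried `ω'`-open edges are open in `ω →_S ω'`
  have hoff' : ∀ e, e ∉ S → ω' e = true → mix S ω ω' e = true := fun e he h => by
    rw [mix_apply_of_notMem he]; exact h
  by_cases hmm : m₂ ≤ m₁
  · -- `v₁` at least as deep as `v₂`: `a ~ v₁ ~ c'` in `ω`, `c' ~ v₂ ~ u` in `ω →_S ω'`
    left
    refine ⟨{e | offS S ω e = true} ∪ {e | e ∈ (L.drop m₁).map Prod.fst},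
      {e | offS S ω' e = true} ∪ {e | e ∈ (L.take m₂).map Prod.fst}, ?_, ?_, ?_⟩
    · intro ζ hζ
      have hle : offS S ω ≤ ζ := offS_le fun e he h => by
        rw [hζ e (Or.inl (offS_eq_true_iff.mpr ⟨he, h⟩))]; exact h
      have hca : G.Conn ζ c' a :=
        (hc₁.mono hle).trans (hdrop₁ ζ fun x hx => hζ x.1 (Or.inr (List.mem_map_of_mem hx)))
      exact hca.symm
    · intro ζ hζ
      have hle : offS S ω' ≤ ζ := offS_le fun e he h => by
        rw [hζ e (Or.inl (offS_eq_true_iff.mpr ⟨he, h⟩)), hoff' e he h]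
      have hζL : ∀ x ∈ L.take m₂, ζ x.1 = ω x.1 := fun x hx => by
        rw [hζ x.1 (Or.inr (List.mem_map_of_mem hx))]
        exact hmixL x (List.take_subset _ _ hx)
      exact (hc₂.mono hle).trans (htake₂ ζ hζL).symm
    · intro e ⟨hI, hJ⟩ heS
      rcases hI with hI | hI
      · exact (offS_eq_true_iff.mp hI).1 heS
      rcases hJ with hJ | hJ
      · exact (offS_eq_true_iff.mp hJ).1 heS
      exact take_drop_disjoint hnd hmm hJ hI
  · -- `v₂` deeper than `v₁`: `c' ~ v₁ ~ u` in `ω`, `a ~ v₂ ~ c'` in `ω →_S ω'`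
    right
    have hmm' : m₁ ≤ m₂ := le_of_lt (not_le.mp hmm)
    refine ⟨{e | offS S ω e = true} ∪ {e | e ∈ (L.take m₁).map Prod.fst},
      {e | offS S ω' e = true} ∪ {e | e ∈ (L.drop m₂).map Prod.fst}, ?_, ?_, ?_⟩
    · intro ζ hζ
      have hle : offS S ω ≤ ζ := offS_le fun e he h => by
        rw [hζ e (Or.inl (offS_eq_true_iff.mpr ⟨he, h⟩))]; exact h
      exact (hc₁.mono hle).trans
        (htake₁ ζ fun x hx => hζ x.1 (Or.inr (List.mem_map_of_mem hx))).symm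
    · intro ζ hζ
      have hle : offS S ω' ≤ ζ := offS_le fun e he h => by
        rw [hζ e (Or.inl (offS_eq_true_iff.mpr ⟨he, h⟩)), hoff' e he h]
      have hζL : ∀ x ∈ L.drop m₂, ζ x.1 = ω x.1 := fun x hx => by
        rw [hζ x.1 (Or.inr (List.mem_map_of_mem hx))]
        exact hmixL x (List.drop_subset _ _ hx)
      exact ((hc₂.mono hle).trans (hdrop₂ ζ hζL)).symm
    · intro e ⟨hI, hJ⟩ heS
      rcases hI with hI | hI
      · exact (offS_eq_true_iff.mp hI).1 heS
      rcases hJ with hJ | hJ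
      · exact (offS_eq_true_iff.mp hJ).1 heS
      exact take_drop_disjoint hnd hmm' hI hJ

/-- **The witness pairs at a stop leaf**, by the target found: if the DFS from `a` with targets
`{b, c}` stopped at `u` and `a`, `b`, `c` are joined in `ω` and in `ω →_S ω'`, then for `u = b`
the pair lies in `ac □_S bc ∪ bc □_S ac`, and for `u = c` in `ab □_S bc ∪ bc □_S ab`. -/
theorem disjOcc_of_leafState_stop [DecidableEq V] {a b c : V} (hbc : b ≠ c) {ω ω' : Config E}
    {S : Set E} {u : V} (hleaf : G.LeafState {b, c} a ω S (some u))
    (h1 : G.Conn ω a b ∧ G.Conn ω b c) (h2 : G.Conn (mix S ω ω') a b ∧ G.Conn (mix S ω ω') b c) :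
    (u = b → DisjOcc (G.connEvent a c) (G.connEvent b c) S ω ω' ∨
        DisjOcc (G.connEvent b c) (G.connEvent a c) S ω ω') ∧
      (u = c → DisjOcc (G.connEvent a b) (G.connEvent b c) S ω ω' ∨
        DisjOcc (G.connEvent b c) (G.connEvent a b) S ω ω') := by
  rcases hleaf with ⟨top, L, Q, e, u', hr, hu, heS, hωe, hends, henotL, hpath, hLS, hnd, hQ,
      hopenIn, hnoT⟩ | ⟨hr, -⟩
  · have huu : u = u' := Option.some_injective _ hr
    subst huu
    -- extend the stack by the stop edge
    have hpathx : G.PathOK ω ((e, top) :: L) u a := by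
      refine ⟨hωe, ?_, hpath⟩
      rcases hends with ⟨h1', h2'⟩ | ⟨h1', h2'⟩
      · exact Or.inr ⟨h1', h2'⟩
      · exact Or.inl ⟨h1', h2'⟩
    have hLSx : ∀ x ∈ (e, top) :: L, x.1 ∈ S := by
      intro x hx
      rcases List.mem_cons.mp hx with rfl | hx
      · exact heS
      · exact hLS x hx
    have hndx : (((e, top) :: L).map Prod.fst).Nodup := by
      rw [List.map_cons, List.nodup_cons]; exact ⟨henotL, hnd⟩
    have hexpl : ∀ x, x ∈ explored top L Q → x ∈ explored u ((e, top) :: L) Q := by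
      intro x hx
      rw [mem_explored] at hx ⊢
      rw [List.map_cons, List.mem_cons]
      tauto
    have hopenInx : ∀ e' ∈ S, ω e' = true →
        G.fst e' ∈ explored u ((e, top) :: L) Q ∧ G.snd e' ∈ explored u ((e, top) :: L) Q := by
      intro e' he' hopen
      by_cases hee : e' = e
      · rw [hee]
        rcases hends with ⟨h1', h2'⟩ | ⟨h1', h2'⟩
        · exact ⟨hexpl _ (h1' ▸ Or.inl rfl), by rw [h2']; exact Or.inl rfl⟩
        · exact ⟨by rw [h1']; exact Or.inl rfl, hexpl _ (h2' ▸ Or.inl rfl)⟩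
      · have := hopenIn e' he' hee hopen
        exact ⟨hexpl _ this.1, hexpl _ this.2⟩
    -- the other target is unexplored
    have hnotx : ∀ t, t ∈ ({b, c} : Finset V) → t ≠ u → t ∉ explored u ((e, top) :: L) Q := by
      intro t ht htu hmem
      rw [mem_explored, List.map_cons, List.mem_cons] at hmem
      simp only at hmem
      rcases hmem with h | (h | h) | h
      · exact htu h
      · exact hnoT t ht (Or.inl h)
      · exact hnoT t ht (Or.inr (Or.inl h))
      · exact hnoT t ht (Or.inr (Or.inr h))
    constructor
    · -- stopped at `b`; the other target is `c`
      rintro rfl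
      have hc : c ∉ explored u ((e, top) :: L) Q :=
        hnotx c (Finset.mem_insert_of_mem (Finset.mem_singleton_self c)) (Ne.symm hbc)
      have hca : G.Conn ω c a := (h1.1.trans h1.2).symm
      have hca' : G.Conn (mix S ω ω') c a := (h2.1.trans h2.2).symm
      rcases disjOcc_core hpathx hLSx hndx hQ hopenInx hc hca hca' with h | h
      · left
        refine disjOcc_mono (Set.Subset.refl _) ?_ h
        rw [connEvent_comm]
      · right
        refine disjOcc_mono ?_ (Set.Subset.refl _) h
        rw [connEvent_comm]
    · -- stopped at `c`; the other target is `b`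
      rintro rfl
      have hb : b ∉ explored u ((e, top) :: L) Q :=
        hnotx b (Finset.mem_insert_self b _) hbc
      have hba : G.Conn ω b a := h1.1.symm
      have hba' : G.Conn (mix S ω ω') b a := h2.1.symm
      exact disjOcc_core hpathx hLSx hndx hQ hopenInx hb hba hba'
  · exact absurd hr (Option.some_ne_none u)

/-- **An exhausted leaf is impossible when `a ~ b`.** -/
theorem leafState_ne_none [DecidableEq V] {a b c : V} {ω : Config E} {S : Set E} {r : Option V}
    (hleaf : G.LeafState {b, c} a ω S r) (hab : G.Conn ω a b) : r ≠ none := by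
  rcases hleaf with ⟨_, _, _, _, u, hr, -⟩ | ⟨hr, Q, haQ, hQ, hopenIn, hnoT⟩
  · rw [hr]; exact Option.some_ne_none u
  · exfalso
    have hX : ∀ e, ω e = true → (G.fst e ∈ (Q : Set V) ↔ G.snd e ∈ (Q : Set V)) := by
      intro e hopen
      by_cases heS : e ∈ S
      · have := hopenIn e heS hopen
        exact ⟨fun _ => this.2, fun _ => this.1⟩
      · constructor
        · intro h; exact absurd (hQ _ h e (Or.inl rfl)) heS
        · intro h; exact absurd (hQ _ h e (Or.inr rfl)) heS
    have hbQ : b ∈ (Q : Set V) := mem_of_conn_of_closed_boundary hX haQ hab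
    exact hnoT b (Finset.mem_insert_self b _) hbQ

/-- **The event inclusion of Gladkov's §6.2**: at a leaf of the DFS from `a` with targets
`{b, c}`, if `a`, `b`, `c` are joined in `ω` and in `ω →_S ω'` (`S` the queried set), the pair
lies in `(ab ∪ ac) □_S bc ∪ bc □_S (ab ∪ ac)`. -/
theorem disjOcc_of_leafState [DecidableEq V] {a b c : V} (hbc : b ≠ c) {ω ω' : Config E}
    {S : Set E} {r : Option V} (hleaf : G.LeafState {b, c} a ω S r)
    (h1 : G.Conn ω a b ∧ G.Conn ω b c) (h2 : G.Conn (mix S ω ω') a b ∧ G.Conn (mix S ω ω') b c) :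
    DisjOcc (G.connEvent a b ∪ G.connEvent a c) (G.connEvent b c) S ω ω' ∨
      DisjOcc (G.connEvent b c) (G.connEvent a b ∪ G.connEvent a c) S ω ω' := by
  obtain ⟨u, hu⟩ := Option.ne_none_iff_exists'.mp (leafState_ne_none hleaf h1.1)
  rw [hu] at hleaf
  have huT : u ∈ ({b, c} : Finset V) := by
    rcases hleaf with ⟨_, _, _, _, u', hr, hu', -⟩ | ⟨hr, -⟩
    · rw [Option.some_injective _ hr]; exact hu'
    · exact absurd hr (Option.some_ne_none u)
  obtain ⟨hb, hc⟩ := disjOcc_of_leafState_stop hbc hleaf h1 h2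
  rcases Finset.mem_insert.mp huT with rfl | hu'
  · rcases hb rfl with h | h
    · exact Or.inl (disjOcc_mono Set.subset_union_right (Set.Subset.refl _) h)
    · exact Or.inr (disjOcc_mono (Set.Subset.refl _) Set.subset_union_right h)
  · rcases hc (Finset.mem_singleton.mp hu') with h | h
    · exact Or.inl (disjOcc_mono Set.subset_union_left (Set.Subset.refl _) h)
    · exact Or.inr (disjOcc_mono (Set.Subset.refl _) Set.subset_union_left h)

end MultiGraph

end PercRepro
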